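import Literature.NumberTheory.EllipticCurves.FunctionFieldSelmerAssembly
import Literature.NumberTheory.EllipticCurves.FunctionFieldUnramifiedProofs
import Literature.NumberTheory.EllipticCurves.SelmerInertia
import HarnessLib

/-!
# Selmer classes are unramified outside `S` over a global function field
# (Milne ADT I.6.5 / Silverman AEC Cor. X.4.4 over `F`): decomposition and glue

Sixth decomposition file (D-0014/D-0026, provefact seat on
`Literature.NumberTheory.EllipticCurves.FunctionField.finite_shaPrimeToChar_torsionBy`, statement
file `FunctionField`, bsd.S33). `FunctionFieldSelmerAssembly`/`FunctionFieldH1Finite` reduce the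
statement-file fact to the single step `h44`:

> for `n` invertible in the global function field `F` and `S ⊇ badPlaces W`, every Selmer
> class is unramified outside `S`: `Sel^(n)(E/F) ⊆ H¹(G_F, E[n]; S)`.

This is Silverman, *AEC*, Cor. X.4.4 over `F` (Milne, *ADT*, I.§6 Prop. 6.5, first exact sequence
with Lemma 6.1), and this file is the function-field copy of the tree's number-field
decomposition file `SelmerInertia`: the local condition of the Selmer group is phrased with the
completion `F_v` (`Γ_{F_v}` acting on `E(F̄_v)`, restriction `Γ_{F_v} → Γ_F` along a chosen
`F`-embedding `ι : F̄ → F̄_v`, files `Sha`/`Selmer`/`FunctionFieldSelmer`), whereas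
`H¹(G_F, M; S)` is phrased with the inertia groups `I_𝔓 ≤ Γ_F` of the primes `𝔓` of
`\bar O_v = absIntegers O_v F` (`FunctionFieldUnramified`); accordingly the proof splits into

* **(LG)** local–global compatibility of inertia (Neukirch, *ANT*, II (9.6)): every element of
  `I_𝔓`, for the prime `𝔓 = 𝔓_{ι,𝔐}` cut out by `ι` and a prime `𝔐` of the local absolute
  integers, is the restriction of an element of the local inertia group `I_𝔐 ≤ Γ_{F_v}`;
* **(RED)** the reduction step (Silverman X.§4, proof of Thm. 4.2(b): inertia acts trivially on
  `Ẽ_v` and `E[n] ↪ Ẽ_v` for `v ∤ n` of good reduction);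
* **everything else, proved here**: the cocycle bookkeeping and the passage from the prime cut
  out by the chosen embedding to all primes above `v` (transitivity of `Γ_F`,
  `Place.exists_smul_eq_of_mem_primesAbove` of `FunctionFieldUnramifiedProofs`, every
  characteristic; change of embedding; independence of the local kernel from the embedding,
  `selmerLocalKer_eq_of_algHom_holds`).

Following D-0026, (LG) and (RED) are **not** vendored as named facts: they enter the glue
`selmerGroup_le_h1Unramified_of_local` as explicit hypotheses and are proved in the sibling
`Proofs` files of this seat.

## Main declarations (all for a place `v : Place F` of a field `F`)

* `Place.localAbsIntegers v` (`\bar O_{F_v}`, the integral closure of `O_{F_v} = v.CompletionIntegers`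
  in `F̄_v`), `Place.localPrimesAbove v` (its primes above `𝔪_{F_v}`; nonempty),
  `Place.absIntegersToLocal v ι : \bar O_v →+* \bar O_{F_v}`, `Place.primeBelow v ι 𝔐 = 𝔓_{ι,𝔐}`
  (a prime above `v`, `primeBelow_mem_primesAbove`; `primeBelow_comp`).
* `selmerLocalKerOfEmb_le_unramifiedKer_primeBelow`, `selmerLocalKer_le_unramifiedKer`,
  `selmerGroup_le_h1Unramified_of_local` (**proved**): `(LG at every v ∉ S) → (RED) → h44`
  (the hypothesis of `FunctionFieldH1Finite.finite_shaPrimeToChar_torsionBy_of_selmerGroup_le_h1Unramified`).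

## References

* [SilvermanAEC2009] J. H. Silverman, *The Arithmetic of Elliptic Curves*, 2nd ed., X.§4
  (decomposition groups `G_v`, Remark 4.1.1, Thm. 4.2 and its proof, Cor. 4.4); VIII.§2,
  Definition before Prop. 2.1.
* [NeukirchANT1999] J. Neukirch, *Algebraic Number Theory*, Ch. II §8 (8.1), §9 Prop. (9.6).
* [MilneADT2006] J. S. Milne, *Arithmetic Duality Theorems*, 2nd ed., I.§6 Prop. 6.5, Lemma 6.1.

## Design

As `SelmerInertia`: `noncomputable section`, `open scoped Classical`, `F : Type`; the local
objects in `namespace …FunctionField.Place` for the dot notation `v.localAbsIntegers`; the local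
inertia group is `𝔐.inertia Γ_{F_v}` (Mathlib's `Ideal.inertia`) for a prime `𝔐` of
`\bar O_{F_v}` above `𝔪_{F_v}` (there is exactly one; statements quantify over it).
-/

noncomputable section

open scoped Classical Polynomial Pointwise

namespace Literature.NumberTheory.EllipticCurves.FunctionField

open Literature.NumberTheory.EllipticCurves Literature.NumberTheory.GaloisRepresentations Field
  IsDedekindDomain WeierstrassCurve

variable {F : Type} [Field F]

/-! ## Local absolute integers at a place; the prime of `\bar O_v` cut out by an embedding -/

namespace Place

variable (v : Place F)

/-- The ring `\bar O_{F_v} ⊆ F̄_v` of **local absolute integers** at the place `v`: the integral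
closure of the complete discrete valuation ring `O_{F_v} = v.CompletionIntegers` in the algebraic
closure `F̄_v` of the completion (`absIntegers`, with its action of `Γ_{F_v}`). Function-field
copy of `IsDedekindDomain.HeightOneSpectrum.localAbsIntegers`.
Neukirch, *ANT*, Ch. II §8–§9; Silverman, *AEC*, VII.§1 and X.§4. [folklore] -/
abbrev localAbsIntegers : Subalgebra v.CompletionIntegers (AlgebraicClosure v.Completion) :=
  absIntegers v.CompletionIntegers v.Completion

/-- The primes of `\bar O_{F_v}` above the maximal ideal of `O_{F_v}` (Mathlib's
`Ideal.primesOver`). Neukirch, *ANT*, Ch. II (6.2), (8.1). [folklore] -/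
def localPrimesAbove : Set (Ideal (localAbsIntegers v)) :=
  (IsLocalRing.maximalIdeal v.CompletionIntegers).primesOver (localAbsIntegers v)

variable {v} in
/-- Membership in `v.localPrimesAbove`: prime and lying over `𝔪_{F_v}`. [folklore] -/
theorem mem_localPrimesAbove_iff {𝔐 : Ideal (localAbsIntegers v)} :
    𝔐 ∈ v.localPrimesAbove ↔
      𝔐.IsPrime ∧ 𝔐.LiesOver (IsLocalRing.maximalIdeal v.CompletionIntegers) :=
  Iff.rfl

/-- `\bar O_{F_v}` has a prime above `𝔪_{F_v}` (lying over for an integral extension).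
Neukirch, *ANT*, Ch. II (8.1). [folklore] -/
theorem localPrimesAbove_nonempty : (v.localPrimesAbove).Nonempty := by
  have hinj : Function.Injective
      (algebraMap v.CompletionIntegers (AlgebraicClosure v.Completion)) := by
    rw [IsScalarTower.algebraMap_eq v.CompletionIntegers v.Completion
      (AlgebraicClosure v.Completion)]
    exact (algebraMap v.Completion _).injective.comp Subtype.val_injective
  haveI : FaithfulSMul v.CompletionIntegers (localAbsIntegers v) :=
    (faithfulSMul_iff_algebraMap_injective _ _).mpr fun x y h => hinj (congrArg Subtype.val h)
  obtain ⟨𝔐, h𝔐, h⟩ :=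
    Ideal.exists_maximal_ideal_liesOver_of_isIntegral (S := localAbsIntegers v)
      (IsLocalRing.maximalIdeal v.CompletionIntegers)
  exact ⟨𝔐, h𝔐.isPrime, h⟩

variable (ι : AlgebraicClosure F →ₐ[F] AlgebraicClosure v.Completion)

/-- An `F`-embedding `ι : F̄ → F̄_v` maps `\bar O_v` into the local absolute integers
(integral over `O_v ⊆ O_{F_v}`). Neukirch, *ANT*, Ch. II §8. [folklore] -/
theorem isIntegral_apply_of_mem_absIntegers {b : AlgebraicClosure F}
    (hb : b ∈ absIntegers v.1 F) : IsIntegral v.CompletionIntegers (ι b) := by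
  have h1 : IsIntegral v.1 (ι b) := (mem_integralClosure_iff v.1 _).mp hb |>.map ι
  obtain ⟨p, hp, hpb⟩ := h1
  refine ⟨p.map (algebraMap v.1 v.CompletionIntegers), hp.map _, ?_⟩
  rw [Polynomial.eval₂_map]
  convert hpb using 2
  ext x
  change algebraMap v.Completion (AlgebraicClosure v.Completion)
      ((algebraMap v.1 v.CompletionIntegers x : v.Completion)) = _
  rw [IsScalarTower.algebraMap_apply v.1 F (AlgebraicClosure v.Completion),
    IsScalarTower.algebraMap_apply F v.Completion (AlgebraicClosure v.Completion)]
  rfl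

/-- The ring homomorphism `\bar O_v → \bar O_{F_v}` induced by an `F`-embedding `ι : F̄ → F̄_v`.
Neukirch, *ANT*, Ch. II §8 (the embedding `L ↪ L_w`). [folklore] -/
def absIntegersToLocal : absIntegers v.1 F →+* localAbsIntegers v where
  toFun b := ⟨ι b, (mem_integralClosure_iff _ _).mpr (isIntegral_apply_of_mem_absIntegers v ι b.2)⟩
  map_one' := Subtype.ext (map_one ι)
  map_mul' x y := Subtype.ext (map_mul ι x.1 y.1)
  map_zero' := Subtype.ext (map_zero ι)
  map_add' x y := Subtype.ext (map_add ι x.1 y.1)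

/-- Unfolding `absIntegersToLocal`. [folklore] -/
@[simp]
theorem coe_absIntegersToLocal_apply (b : absIntegers v.1 F) :
    (absIntegersToLocal v ι b : AlgebraicClosure v.Completion) = ι b :=
  rfl

/-- The prime `𝔓_{ι,𝔐} = ι⁻¹(𝔐) ∩ \bar O_v` of `\bar O_v` **cut out by** the embedding
`ι : F̄ → F̄_v` and a prime `𝔐` of `\bar O_{F_v}` (Silverman's extension of `v` to `F̄` attached to
`F̄ ⊂ F̄_v`, AEC X.§4; Neukirch's `w = \bar v ∘ τ`, ANT II (8.1)). [folklore] -/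
def primeBelow (𝔐 : Ideal (localAbsIntegers v)) : Ideal (absIntegers v.1 F) :=
  𝔐.comap (absIntegersToLocal v ι)

variable {v ι}

/-- Membership in `primeBelow`: `b ∈ 𝔓_{ι,𝔐} ↔ ι b ∈ 𝔐`. [folklore] -/
theorem mem_primeBelow_iff {𝔐 : Ideal (localAbsIntegers v)} {b : absIntegers v.1 F} :
    b ∈ v.primeBelow ι 𝔐 ↔ absIntegersToLocal v ι b ∈ 𝔐 :=
  Ideal.mem_comap

/-- The maximal ideal of `O_{F_v}` is cut out by `Valued.v < 1`. [folklore] -/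
theorem mem_maximalIdeal_completionIntegers_iff {a : v.CompletionIntegers} :
    a ∈ IsLocalRing.maximalIdeal v.CompletionIntegers ↔ Valued.v (a : v.Completion) < 1 :=
  Valuation.mem_maximalIdeal_iff _ _

/-- An element of `O_v` lies in `𝔪_{F_v} ⊆ O_{F_v}` iff it lies in `𝔪_v`. [folklore] -/
theorem algebraMap_mem_maximalIdeal_completionIntegers_iff (x : v.1) :
    algebraMap v.1 v.CompletionIntegers x ∈ IsLocalRing.maximalIdeal v.CompletionIntegers ↔
      x ∈ (v.spectrum).asIdeal := by
  rw [mem_maximalIdeal_completionIntegers_iff]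
  change Valued.v ((algebraMap v.1 F x : F) : v.Completion) < 1 ↔ _
  rw [HeightOneSpectrum.valuedAdicCompletion_eq_valuation',
    HeightOneSpectrum.valuation_lt_one_iff_mem]

/-- `absIntegersToLocal` is compatible with the structure maps from `O_v`. [folklore] -/
theorem absIntegersToLocal_algebraMap (x : v.1) :
    absIntegersToLocal v ι (algebraMap v.1 (absIntegers v.1 F) x) =
      algebraMap v.CompletionIntegers (localAbsIntegers v) (algebraMap v.1 v.CompletionIntegers x) := by
  apply Subtype.ext
  rw [coe_absIntegersToLocal_apply]
  change ι (algebraMap v.1 (AlgebraicClosure F) x) =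
    algebraMap v.CompletionIntegers (AlgebraicClosure v.Completion)
      (algebraMap v.1 v.CompletionIntegers x)
  rw [IsScalarTower.algebraMap_apply v.1 F (AlgebraicClosure F), ι.commutes,
    IsScalarTower.algebraMap_apply F v.Completion (AlgebraicClosure v.Completion),
    IsScalarTower.algebraMap_apply v.CompletionIntegers v.Completion (AlgebraicClosure v.Completion)]
  congr 1

/-- `𝔓_{ι,𝔐}` lies above `v` when `𝔐` lies above `𝔪_{F_v}`. Neukirch, *ANT*, Ch. II (8.1).
[folklore] -/
theorem primeBelow_mem_primesAbove {𝔐 : Ideal (localAbsIntegers v)}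
    (h𝔐 : 𝔐 ∈ v.localPrimesAbove) : v.primeBelow ι 𝔐 ∈ v.primesAbove := by
  haveI := h𝔐.1
  refine ⟨Ideal.comap_isPrime _ _, ⟨?_⟩⟩
  ext x
  rw [Ideal.under_def, Ideal.mem_comap, mem_primeBelow_iff, absIntegersToLocal_algebraMap,
    ← Ideal.mem_comap, ← Ideal.under_def, ← h𝔐.2.over,
    algebraMap_mem_maximalIdeal_completionIntegers_iff]
  rfl

/-- Changing the embedding by `τ ∈ Γ_F` moves the prime cut out by it:
`𝔓_{ι ∘ τ, 𝔐} = τ⁻¹ • 𝔓_{ι,𝔐}`. Neukirch, *ANT*, Ch. II (8.1) and (9.1). [folklore] -/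
theorem primeBelow_comp (τ : AlgebraicClosure F ≃ₐ[F] AlgebraicClosure F)
    (𝔐 : Ideal (localAbsIntegers v)) :
    v.primeBelow (ι.comp (τ : AlgebraicClosure F →ₐ[F] AlgebraicClosure F)) 𝔐 =
      (show absoluteGaloisGroup F from τ)⁻¹ • v.primeBelow ι 𝔐 := by
  ext b
  rw [mem_primeBelow_iff, Ideal.mem_inv_pointwise_smul_iff, mem_primeBelow_iff]
  exact Iff.of_eq (congrArg (· ∈ 𝔐) (Subtype.ext rfl))

end Place

/-! ## Cor. X.4.4 from (LG) and (RED) -/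

section Glue

variable (W : WeierstrassCurve F)

/-- **Cor. X.4.4 over `F`, local form at one embedding.** For an elliptic curve `E/F`, a place `v`
of good reduction, `n` invertible in `F`, an `F`-embedding `ι : F̄ → F̄_v` and a prime `𝔐` of
`\bar O_{F_v}` above `𝔪_{F_v}`: every class of `H¹(F, E[n])` dying in `H¹(F_v, E)` (the local
Selmer condition along `ι`) is unramified at the prime `𝔓_{ι,𝔐}` of `\bar O_v` cut out by `ι`,
granted (LG) at `(v, ι, 𝔐)` and (RED) at `(v, 𝔐)`. Proof as printed (Silverman, *AEC*, X.§4,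
proof of Thm. 4.2(b)): a cocycle `ξ` of the class satisfies `ι_* ξ_{res σ} = P^σ - P` on
`Γ_{F_v}` for some `P ∈ E(F̄_v)`; for `τ ∈ I_𝔓` pick `σ ∈ I_𝔐` above it; `n (P^σ - P) = O`, so
`P^σ = P` and `ξ_τ = 0`. The tree's `selmerLocalKerOfEmb_le_unramifiedKer_primeBelow` over `F`.
[cite: SilvermanAEC2009, Cor. X.4.4 (proof of Thm. X.4.2(b))] -/
theorem selmerLocalKerOfEmb_le_unramifiedKer_primeBelow {v : Place F}
    {ι : AlgebraicClosure F →ₐ[F] AlgebraicClosure v.Completion}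
    {𝔐 : Ideal v.localAbsIntegers} {n : ℤ}
    (hlg : ∀ {τ : absoluteGaloisGroup F}, τ ∈ (v.primeBelow ι 𝔐).inertia (absoluteGaloisGroup F) →
      ∃ σ ∈ 𝔐.inertia (absoluteGaloisGroup v.Completion),
        ∀ x : AlgebraicClosure F, ι (τ • x) = σ • ι x)
    (hred : ∀ {σ : absoluteGaloisGroup v.Completion},
      σ ∈ 𝔐.inertia (absoluteGaloisGroup v.Completion) →
      ∀ {P : localPoints W v.Completion}, n • (σ • P - P) = 0 → σ • P = P) :
    selmerLocalKerOfEmb W v.Completion ι n ≤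
      unramifiedKer (geomTorsion W n) v (v.primeBelow ι 𝔐) := by
  intro c hc
  obtain ⟨φ, rfl⟩ :=
    oneCocycleClass_surjective (discreteTopRep (absoluteGaloisGroup F) (geomTorsion W n)) c
  -- the local condition: `ι_* φ (res σ) = σ • P - P` on `Γ_{F_v}` for some `P ∈ E(F̄_v)`
  obtain ⟨P, hP⟩ := (oneCocycleClass_mem_resKer_iff _ _ _ φ).mp hc
  -- goal: `φ` is principal on `I_𝔓`; indeed it vanishes there
  refine (oneCocycleClass_mem_subgroupResKer_iff _ φ).mpr ⟨0, fun τ ↦ ?_⟩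
  rw [smul_zero, sub_zero]
  obtain ⟨σ, hσI, hσ⟩ := hlg τ.2
  have hT : pointsMapOfEmb W ι (φ.1 (τ : absoluteGaloisGroup F) : geomPoints W) = σ • P - P := by
    rw [← resGalOfEmb_eq_of_apply_eq ι hσ]
    exact hP σ
  -- `n • (σ • P - P) = 0`, hence `σ • P = P` by the reduction step
  have hn0 : n • ((φ.1 (τ : absoluteGaloisGroup F) : geomTorsion W n) : geomPoints W) = 0 :=
    (Submodule.mem_torsionBy_iff n _).mp (φ.1 (τ : absoluteGaloisGroup F)).2
  have hfix : σ • P = P := by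
    refine hred hσI ?_
    rw [← hT, ← map_zsmul, hn0, map_zero]
  rw [hfix, sub_self] at hT
  exact Subtype.ext ((injective_iff_map_eq_zero _).mp (pointsMapOfEmb_injective W ι) _ hT)

/-- **Cor. X.4.4 over `F`, local form.** For an elliptic curve `E/F`, a place `v`, `n`, and *every*
prime `𝔓` of `\bar O_v` above `v`: the local Selmer condition at `v` (tree convention: the chosen
embedding `closureEmb : F̄ → F̄_v`) forces a class of `H¹(F, E[n])` to be unramified at `𝔓`,
granted (LG) for all embeddings at some prime `𝔐` of `\bar O_{F_v}` above `𝔪_{F_v}` and (RED) at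
`𝔐`. Reduction to `selmerLocalKerOfEmb_le_unramifiedKer_primeBelow`: `Γ_F` is transitive on the
primes above `v` (`Place.exists_smul_eq_of_mem_primesAbove`, every characteristic),
`𝔓 = g • 𝔓_{ι₀,𝔐} = 𝔓_{ι₀ ∘ g⁻¹, 𝔐}` (`primeBelow_comp`), and the local kernel does not depend on
the embedding (`selmerLocalKer_eq_of_algHom_holds`). Silverman, *AEC*, VIII.§2 (Definition before
Prop. 2.1), Remark X.4.1.1. [cite: SilvermanAEC2009, Cor. X.4.4] -/
theorem selmerLocalKer_le_unramifiedKer {v : Place F} {𝔐 : Ideal v.localAbsIntegers}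
    (h𝔐 : 𝔐 ∈ v.localPrimesAbove) {n : ℤ}
    (hlg : ∀ (ι : AlgebraicClosure F →ₐ[F] AlgebraicClosure v.Completion)
      {τ : absoluteGaloisGroup F}, τ ∈ (v.primeBelow ι 𝔐).inertia (absoluteGaloisGroup F) →
      ∃ σ ∈ 𝔐.inertia (absoluteGaloisGroup v.Completion),
        ∀ x : AlgebraicClosure F, ι (τ • x) = σ • ι x)
    (hred : ∀ {σ : absoluteGaloisGroup v.Completion},
      σ ∈ 𝔐.inertia (absoluteGaloisGroup v.Completion) →
      ∀ {P : localPoints W v.Completion}, n • (σ • P - P) = 0 → σ • P = P)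
    {𝔓 : Ideal (absIntegers v.1 F)} (h𝔓 : 𝔓 ∈ v.primesAbove) :
    selmerLocalKer W v.Completion n ≤ unramifiedKer (geomTorsion W n) v 𝔓 := by
  obtain ⟨g, hg⟩ := Place.exists_smul_eq_of_mem_primesAbove v
    (Place.primeBelow_mem_primesAbove (ι := closureEmb (K := F) v.Completion) h𝔐) h𝔓
  have h1 : 𝔓 = v.primeBelow ((closureEmb (K := F) v.Completion).comp
      ((show AlgebraicClosure F ≃ₐ[F] AlgebraicClosure F from g⁻¹) :
        AlgebraicClosure F →ₐ[F] AlgebraicClosure F)) 𝔐 := by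
    rw [Place.primeBelow_comp, ← hg]
    exact congrArg (· • _) (inv_inv g).symm
  rw [h1, ← selmerLocalKer_eq_of_algHom_holds W v.Completion _ n]
  exact selmerLocalKerOfEmb_le_unramifiedKer_primeBelow W (hlg _) hred

/-- **Silverman, AEC Cor. X.4.4 over a global function field, from its two local ingredients**
(Milne, *ADT*, I.§6 Prop. 6.5): for an elliptic curve `E/F`, `n` invertible in `F` and `S` a set
of places containing the bad places, `Sel^(n)(E/F) ⊆ H¹(G_F, E[n]; S)` — the hypothesis `h44`
of `finite_shaPrimeToChar_torsionBy_of_selmerGroup_le_h1Unramified` — granted, for every place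
`v ∉ S`, a prime `𝔐` of `\bar O_{F_v}` above `𝔪_{F_v}` with (LG) the local–global compatibility
of inertia for every embedding (Neukirch II (9.6)) and (RED) the reduction step of the printed
proof at the good place `v` (inertia fixes `P` whenever `n (P^σ - P) = O`). For `n` invertible
in `F` no place divides `n`, so `S` need only contain the bad places.
[cite: SilvermanAEC2009, Cor. X.4.4 (proof of Thm. X.4.2(b))] -/
theorem selmerGroup_le_h1Unramified_of_local {n : ℤ} {S : Set (Place F)}
    (hloc : ∀ v : Place F, v ∉ S → ∃ 𝔐 ∈ v.localPrimesAbove,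
      (∀ (ι : AlgebraicClosure F →ₐ[F] AlgebraicClosure v.Completion)
        {τ : absoluteGaloisGroup F}, τ ∈ (v.primeBelow ι 𝔐).inertia (absoluteGaloisGroup F) →
        ∃ σ ∈ 𝔐.inertia (absoluteGaloisGroup v.Completion),
          ∀ x : AlgebraicClosure F, ι (τ • x) = σ • ι x) ∧
      (∀ {σ : absoluteGaloisGroup v.Completion},
        σ ∈ 𝔐.inertia (absoluteGaloisGroup v.Completion) →
        ∀ {P : localPoints W v.Completion}, n • (σ • P - P) = 0 → σ • P = P)) :
    selmerGroup W n ≤ h1Unramified (geomTorsion W n) S := by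
  intro c hc
  rw [mem_h1Unramified_iff]
  intro v hv 𝔓 h𝔓
  obtain ⟨𝔐, h𝔐, hlg, hred⟩ := hloc v hv
  exact selmerLocalKer_le_unramifiedKer W h𝔐 hlg hred h𝔓 ((mem_selmerGroup_iff W n c).mp hc v)

end Glue

end Literature.NumberTheory.EllipticCurves.FunctionField

end
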